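import Summits.BirchSwinnertonDyer.BirchSwinnertonDyer.Theorems.ErratumRoadFiveEulerHalfNotRamTateComponentGlobal
import Summits.BirchSwinnertonDyer.Rank1Residual.X11b.BDPRouteLocalNonsingularBridge
import Literature.NumberTheory.NumberFields.ArtinMapDecompositionInertia
import Literature.NumberTheory.GaloisRepresentations.AbsDecompositionFiniteLevelDictionary
import Literature.NumberTheory.Automorphic.GaloisActionPlaces
import HarnessLib

/-!
# ErratumRoadFive, crux `EulerHalfNotRamNoInertSetAtFive` (stmt-BirchSwinnertonDyer-19715), ideator line
# `aux_norm_receptacle`, stub S1 — step F2e: PLACES of a Galois extension `L/K` versus `K`-EMBEDDINGS `L → K̄ → K̄_v`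
# (every place above `v` is cut out by an embedding; embeddings cutting out the same place are `Γ_{K_v}`-conjugate)

Cell `bsd-stepL`, width seat `bsd-line-er5-p1-w3` g6. THEOREMS ONLY (no definition, no named fact, no `sorry`);
`--supports stmt-BirchSwinnertonDyer-19715`. HONEST FRAMING: kernel plumbing (Neukirch II (8.1), (9.6): extensions of a
valuation ↔ embeddings into `K̄_v` modulo `Γ_{K_v}`) for the ideator's stub S1 (`TateComponentFamily[Linear]`); nothing
closes 19715; item 27982 untouched; no summit statement is proved; BSD is proved for no curve.

## What

`K` a number field, `v` a finite place, `w₀` the spectral valuation of `K̄_v` (`hw₀`), `ι_v = closureEmb : K̄ → K̄_v` the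
chosen `K`-embedding; `L/K` finite Galois (an abstract field); for a `K`-embedding `e : L → K̄` write
`ẽ = ι_v ∘ e : L → K̄_v` and say that `e` CUTS OUT the place `w` of `L` when `(w.valuation L).IsEquiv (w₀.comap ẽ)`
(the currency of the tree's `exists_heightOneSpectrum_isEquiv_comap` and of JET's G-rec).

* `under_eq_of_isEquiv` — a place cut out by a `K`-embedding lies over `v`.
* `isEquiv_comap_comp_algEquiv` — if `e` cuts out `w` then `e ∘ g` cuts out `g⁻¹ • w` (`g ∈ G(L/K)`).
* `exists_algHom_isEquiv_of_under_eq` — **every place `w ∣ v` of `L` is cut out by some `K`-embedding** (one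
  embedding cuts out some `w₁ ∣ v`; `G(L/K)` is transitive on the places above `v`, Mathlib
  `Ideal.exists_smul_eq_of_isGaloisGroup` / tree `HeightOneSpectrum.exists_algEquiv_smul_eq`).
* `exists_resGal_apply_eq_of_isEquiv` — **two `K`-embeddings cutting out the same place differ by an element of
  `Γ_{K_v}`**: `∃ t, res(t) (e x) = e' x` for all `x` (`e' = e ∘ g`, `g` in the decomposition group of `w`; lift `g` to
  `γ ∈ Γ_K`, correct by `Gal(K̄/e(L))` using the transitivity of that profinite group on the primes of `\bar ℤ_K` above
  `e(w)` — Mathlib `Algebra.IsInvariant.exists_smul_of_under_eq_of_profinite`, set-up of the tree's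
  `AbsDecompositionFiniteLevelDictionary` — to land in the decomposition group of `𝔓₀ = adicCompletionPrime K v`, which is
  `res(Γ_{K_v})`, tree `decompositionSubgroup_adicCompletionPrime_eq_range`, Neukirch II (9.6)).
* `pointsMap_map_eq_smul_of_isEquiv` — consequently the push-forwards `E_e, E_{e'} : E(L) → E(K̄_v)` of `W/ℚ` differ by
  the action of that `t ∈ Γ_{K_v}`: `E_{e'} P = t • E_e P` — so any `Γ_{K_v}`-invariant function of `E(K̄_v)` (the
  local Tate component character, F1b (4)) takes the same value on them: «same place ⇒ same component».

References (locators only): [cite: NeukirchANT1999, Ch. II (8.1), §9 Prop. (9.6); Ch. I §9 (9.1)]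
[cite: SerreLocalFields1979, Ch. I §7 Prop. 22 (a)] [cite: CasselsFrohlichANT1967, Ch. VII Prop. 1.2 (ii)].
-/

set_option linter.dupNamespace false

noncomputable section

open scoped Classical NNReal Pointwise
open NumberField IsDedekindDomain Field WeierstrassCurve

namespace Summit.BirchSwinnertonDyer.BirchSwinnertonDyer.Theorems.TateComponent

open Literature.NumberTheory.EllipticCurves Literature.NumberTheory.GaloisRepresentations
  IsDedekindDomain.HeightOneSpectrum Summit.BirchSwinnertonDyer.Rank1Residual.X11b
  Literature.NumberTheory.Automorphic

-- pointwise `Γ`-actions on `ℤ̄` and its ideals are found slowly (as in `AbsDecompositionFiniteLevelDictionary`)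
set_option synthInstance.maxHeartbeats 160000

variable {K : Type} [Field K] [NumberField K] {v : HeightOneSpectrum (𝓞 K)}
  {w₀ : Valuation (AlgebraicClosure (v.adicCompletion K)) ℝ≥0}
  (hw₀ : ∀ z, (w₀ z : ℝ) = spectralNorm (v.adicCompletion K) (AlgebraicClosure (v.adicCompletion K)) z)
  {L : Type} [Field L] [NumberField L] [Algebra K L]

/-! ## The place cut out by a `K`-embedding lies over `v` -/

include hw₀ in
/-- For a `K`-embedding `e : L → K̄` cutting out the place `w` of `L` (through `K̄ → K̄_v`): an integer `z ∈ 𝓞 K`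
lies in `w` iff it lies in `v` (`|z|_v < 1 ↔ z ∈ v` for the spectral valuation). [cite: NeukirchANT1999, Ch. II (8.1)] -/
theorem algebraMap_mem_asIdeal_iff_of_isEquiv (e : L →ₐ[K] AlgebraicClosure K) {w : HeightOneSpectrum (𝓞 L)}
    (hwe : (w.valuation L).IsEquiv (w₀.comap
      (((closureEmb (K := K) (v.adicCompletion K)).restrictScalars ℚ).comp (e.restrictScalars ℚ) :
        L →+* AlgebraicClosure (v.adicCompletion K))))
    (z : 𝓞 K) : algebraMap (𝓞 K) (𝓞 L) z ∈ w.asIdeal ↔ z ∈ v.asIdeal := by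
  rw [← HeightOneSpectrum.valuation_lt_one_iff_mem (K := L) w (algebraMap (𝓞 K) (𝓞 L) z),
    Valuation.isEquiv_iff_val_lt_one.mp hwe, Valuation.comap_apply]
  change w₀ (closureEmb (K := K) (v.adicCompletion K) (e (algebraMap K L (z : K)))) < 1 ↔ _
  rw [AlgHom.commutes, AlgHom.commutes,
    IsScalarTower.algebraMap_apply K (v.adicCompletion K) (AlgebraicClosure (v.adicCompletion K)),
    ← NNReal.coe_lt_coe, coe_spectralValuation_algebraMap hw₀, NNReal.coe_one, Valued.toNormedField.norm_lt_one_iff]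
  change Valued.v (((z : K) : v.adicCompletion K)) < 1 ↔ _
  rw [valuedAdicCompletion_eq_valuation']
  exact v.valuation_lt_one_iff_mem z

include hw₀ in
/-- A place of `L` cut out by a `K`-embedding `L → K̄ → K̄_v` lies over `v`. [cite: NeukirchANT1999, Ch. II (8.1)] -/
theorem under_eq_of_isEquiv (e : L →ₐ[K] AlgebraicClosure K) {w : HeightOneSpectrum (𝓞 L)}
    (hwe : (w.valuation L).IsEquiv (w₀.comap
      (((closureEmb (K := K) (v.adicCompletion K)).restrictScalars ℚ).comp (e.restrictScalars ℚ) :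
        L →+* AlgebraicClosure (v.adicCompletion K)))) :
    w.under (𝓞 K) = v := by
  refine HeightOneSpectrum.ext (Ideal.ext fun z ↦ ?_)
  change z ∈ w.asIdeal.comap (algebraMap (𝓞 K) (𝓞 L)) ↔ _
  rw [Ideal.mem_comap]
  exact algebraMap_mem_asIdeal_iff_of_isEquiv hw₀ e hwe z

/-! ## The place cut out by `e ∘ g` -/

/-- If `e` cuts out `w`, then `e ∘ g` cuts out `g⁻¹ • w` for `g ∈ G(L/K)` (`v_{g⁻¹ w}(x) = v_w(g x)`). [folklore] -/
theorem isEquiv_comap_comp_algEquiv (e : L →ₐ[K] AlgebraicClosure K) {w : HeightOneSpectrum (𝓞 L)}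
    (hwe : (w.valuation L).IsEquiv (w₀.comap
      (((closureEmb (K := K) (v.adicCompletion K)).restrictScalars ℚ).comp (e.restrictScalars ℚ) :
        L →+* AlgebraicClosure (v.adicCompletion K))))
    (g : L ≃ₐ[K] L) :
    ((g⁻¹ • w).valuation L).IsEquiv (w₀.comap
      (((closureEmb (K := K) (v.adicCompletion K)).restrictScalars ℚ).comp
        ((e.comp (g : L →ₐ[K] L)).restrictScalars ℚ) : L →+* AlgebraicClosure (v.adicCompletion K))) := by
  -- `v_{g⁻¹ w} = v_w ∘ g`
  have h1 : (g⁻¹ • w).valuation L = (w.valuation L).comap (g : L →+* L) := by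
    refine Valuation.ext fun x ↦ ?_
    rw [Valuation.comap_apply]
    have := HeightOneSpectrum.valuation_algEquiv_smul (F := K) g (g⁻¹ • w) x
    rw [smul_inv_smul] at this
    rw [← this]
    rfl
  rw [h1]
  have h2 : (w₀.comap (((closureEmb (K := K) (v.adicCompletion K)).restrictScalars ℚ).comp
        ((e.comp (g : L →ₐ[K] L)).restrictScalars ℚ) : L →+* AlgebraicClosure (v.adicCompletion K))) =
      (w₀.comap (((closureEmb (K := K) (v.adicCompletion K)).restrictScalars ℚ).comp (e.restrictScalars ℚ) :
        L →+* AlgebraicClosure (v.adicCompletion K))).comap (g : L →+* L) := by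
    refine Valuation.ext fun x ↦ ?_
    rfl
  rw [h2]
  exact hwe.comap (g : L →+* L)

/-! ## Every place above `v` is cut out by a `K`-embedding -/

include hw₀ in
/-- **Every place `w ∣ v` of the finite Galois `L/K` is cut out by some `K`-embedding `L → K̄ → K̄_v`**: one embedding
(`IsAlgClosed.lift`) cuts out some place `w₁ ∣ v` (`exists_heightOneSpectrum_isEquiv_comap`), and `G(L/K)` acts
transitively on the places above `v` (`HeightOneSpectrum.exists_algEquiv_smul_eq`), compatibly with
`isEquiv_comap_comp_algEquiv`. [cite: NeukirchANT1999, Ch. II (8.1)] [cite: CasselsFrohlichANT1967, Ch. VII Prop. 1.2 (ii)] -/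
theorem exists_algHom_isEquiv_of_under_eq [FiniteDimensional K L] [IsGalois K L]
    (w : HeightOneSpectrum (𝓞 L)) (hw : w.under (𝓞 K) = v) :
    ∃ e : L →ₐ[K] AlgebraicClosure K, (w.valuation L).IsEquiv (w₀.comap
      (((closureEmb (K := K) (v.adicCompletion K)).restrictScalars ℚ).comp (e.restrictScalars ℚ) :
        L →+* AlgebraicClosure (v.adicCompletion K))) := by
  set e₁ : L →ₐ[K] AlgebraicClosure K := IsAlgClosed.lift with he₁
  obtain ⟨w₁, hw₁, -⟩ := Literature.NumberTheory.EllipticCurves.exists_heightOneSpectrum_isEquiv_comap hw₀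
    (((closureEmb (K := K) (v.adicCompletion K)).restrictScalars ℚ).comp (e₁.restrictScalars ℚ) :
      L →+* AlgebraicClosure (v.adicCompletion K))
  have hw₁v : w₁.under (𝓞 K) = v := under_eq_of_isEquiv hw₀ e₁ hw₁
  obtain ⟨σ, hσ⟩ := HeightOneSpectrum.exists_algEquiv_smul_eq (F := K) (w := w₁) (w' := w) (hw₁v.trans hw.symm)
  refine ⟨e₁.comp (σ⁻¹ : L ≃ₐ[K] L), ?_⟩
  have key := isEquiv_comap_comp_algEquiv e₁ hw₁ σ⁻¹
  rwa [inv_inv, hσ] at key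

/-! ## Two embeddings cutting out the same place are `Γ_{K_v}`-conjugate -/

omit [NumberField K] [NumberField L] in
/-- Two `K`-embeddings of the normal `L/K` into `K̄` differ by an automorphism of `L`: `e' = e ∘ g`
(Mathlib `AlgHom.restrictNormal'`). [folklore] -/
private theorem exists_algEquiv_comp_eq [Normal K L] (e e' : L →ₐ[K] AlgebraicClosure K) :
    ∃ g : L ≃ₐ[K] L, ∀ x, e (g x) = e' x := by
  letI : Algebra L (AlgebraicClosure K) := e.toRingHom.toAlgebra
  haveI : IsScalarTower K L (AlgebraicClosure K) := IsScalarTower.of_algebraMap_eq fun x ↦ (e.commutes x).symm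
  exact ⟨e'.restrictNormal' L, fun x ↦ AlgHom.restrictNormal_commutes e' L x⟩

include hw₀ in
set_option maxHeartbeats 1600000 in
/-- **Embeddings cutting out the same place are conjugate under `Γ_{K_v}`** (Neukirch II (9.6) / Serre I §7 Prop. 22 (a),
surjectivity of the decomposition group onto the finite one). For `L/K` finite Galois and `K`-embeddings
`e, e' : L → K̄` cutting out the SAME place `w` of `L` through `K̄ → K̄_v`, there is `t ∈ Γ_{K_v}` with
`res(t) (e x) = e' x` for every `x ∈ L` (`res : Γ_{K_v} → Γ_K` the restriction along the chosen `K̄ → K̄_v`).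
[cite: NeukirchANT1999, Ch. II §9 Prop. (9.6)] [cite: SerreLocalFields1979, Ch. I §7 Prop. 22 (a)] -/
theorem exists_resGal_apply_eq_of_isEquiv [FiniteDimensional K L] [IsGalois K L]
    (e e' : L →ₐ[K] AlgebraicClosure K) {w : HeightOneSpectrum (𝓞 L)}
    (hwe : (w.valuation L).IsEquiv (w₀.comap
      (((closureEmb (K := K) (v.adicCompletion K)).restrictScalars ℚ).comp (e.restrictScalars ℚ) :
        L →+* AlgebraicClosure (v.adicCompletion K))))
    (hwe' : (w.valuation L).IsEquiv (w₀.comap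
      (((closureEmb (K := K) (v.adicCompletion K)).restrictScalars ℚ).comp (e'.restrictScalars ℚ) :
        L →+* AlgebraicClosure (v.adicCompletion K)))) :
    ∃ t : absoluteGaloisGroup (v.adicCompletion K), ∀ x : L,
      (show AlgebraicClosure K ≃ₐ[K] AlgebraicClosure K from resGal (K := K) (v.adicCompletion K) t) (e x) = e' x := by
  -- `e' = e ∘ g₀`
  obtain ⟨g₀, hg₀⟩ := exists_algEquiv_comp_eq e e'
  -- membership in `w` read through the two embeddings; `g₀` stabilises `w`
  have hmem : ∀ (f : L →ₐ[K] AlgebraicClosure K), (w.valuation L).IsEquiv (w₀.comap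
      (((closureEmb (K := K) (v.adicCompletion K)).restrictScalars ℚ).comp (f.restrictScalars ℚ) :
        L →+* AlgebraicClosure (v.adicCompletion K))) →
      ∀ z : 𝓞 L, z ∈ w.asIdeal ↔ w₀ (closureEmb (K := K) (v.adicCompletion K) (f (z : L))) < 1 := by
    intro f hf z
    rw [← HeightOneSpectrum.valuation_lt_one_iff_mem (K := L) w z, Valuation.isEquiv_iff_val_lt_one.mp hf,
      Valuation.comap_apply]
    rfl
  have hstab : ∀ z : 𝓞 L, g₀ • z ∈ w.asIdeal ↔ z ∈ w.asIdeal := by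
    intro z
    rw [hmem e hwe, hmem e' hwe']
    change w₀ (closureEmb (K := K) (v.adicCompletion K) (e (g₀ (z : L)))) < 1 ↔ _
    rw [hg₀]
  -- the image `E = e(L) ⊆ K̄`, a finite Galois intermediate field, and `g₀` transported to it
  set E : IntermediateField K (AlgebraicClosure K) := e.fieldRange with hEdef
  set ε : L ≃ₐ[K] E := (show L ≃ₐ[K] e.fieldRange from AlgEquiv.ofInjectiveField e) with hεdef
  have hε : ∀ x : L, ((ε x : E) : AlgebraicClosure K) = e x := fun x ↦ rfl
  haveI : FiniteDimensional K E := LinearEquiv.finiteDimensional ε.toLinearEquiv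
  haveI : IsGalois K E := IsGalois.of_algEquiv ε
  set g : E ≃ₐ[K] E := ε.symm.trans (g₀.trans ε) with hgdef
  have hg : ∀ y : E, ((g y : E) : AlgebraicClosure K) = e (g₀ (ε.symm y)) := fun y ↦ rfl
  -- lift `g` to `γ ∈ Γ_K`
  obtain ⟨γ, hγ⟩ : ∃ γ : absoluteGaloisGroup K, absRestrictNormalHom E γ = g :=
    ((AlgEquiv.restrictNormalHom_surjective (AlgebraicClosure K)).comp
      (absoluteGaloisGroup.toAlgEquiv K).surjective) g
  have hγe : ∀ x : L, γ • e x = e (g₀ x) := by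
    intro x
    have h1 := AlgEquiv.restrictNormal_commutes (absoluteGaloisGroup.toAlgEquiv K γ) E (ε x)
    rw [IntermediateField.algebraMap_apply, IntermediateField.algebraMap_apply, hε] at h1
    have h3 : (absoluteGaloisGroup.toAlgEquiv K γ).restrictNormal E = g := hγ
    rw [h3, hg, AlgEquiv.symm_apply_apply] at h1
    exact h1.symm
  -- the prime `𝔓₀` of `ℤ̄` cut out by `K̄ → K̄_v`, and its trace on `𝓞 E`
  obtain ⟨𝔐, h𝔐⟩ := localPrimesAbove_nonempty (v := v)
  set 𝔓₀ : Ideal (absIntegers (𝓞 K) K) := adicCompletionPrime K v with h𝔓₀def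
  have h𝔓₀ : 𝔓₀ = v.primeBelow (closureEmb (K := K) (v.adicCompletion K)) 𝔐 :=
    (AcSelmer.primeBelow_closureEmb_eq_adicCompletionPrime v h𝔐).symm
  have hmem𝔓₀ : ∀ s : absIntegers (𝓞 K) K,
      s ∈ 𝔓₀ ↔ w₀ (closureEmb (K := K) (v.adicCompletion K) (s : AlgebraicClosure K)) < 1 := by
    intro s
    rw [h𝔓₀, mem_primeBelow_iff, mem_iff_spectralValuation_lt_one hw₀ h𝔐, coe_absIntegersToLocal_apply]
  haveI h𝔓₀p : 𝔓₀.IsPrime := (adicCompletionPrime_mem_primesAbove K v).1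
  set ι := Literature.NumberTheory.EllipticCurves.ringOfIntegersToIntegralClosure (k := K)
    (Ω := AlgebraicClosure K) E with hιdef
  -- membership of `ι y`, `y ∈ 𝓞 E`, in `𝔓₀` is membership of `ε⁻¹ y` in `w`
  have hιmem : ∀ y : 𝓞 E, ι y ∈ 𝔓₀ ↔
      w₀ (closureEmb (K := K) (v.adicCompletion K) (e (ε.symm (y : E)))) < 1 := by
    intro y
    refine (hmem𝔓₀ (ι y)).trans ?_
    change w₀ (closureEmb (K := K) (v.adicCompletion K) ((y : E) : AlgebraicClosure K)) < 1 ↔ _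
    rw [← hε (ε.symm (y : E)), AlgEquiv.apply_symm_apply]
  -- `γ • 𝔓₀` and `𝔓₀` have the same trace on `𝓞 E` (because `g₀` stabilises `w`)
  have htrace : (γ • 𝔓₀).comap ι = 𝔓₀.comap ι := by
    rw [Literature.NumberTheory.NumberFields.comap_ringOfIntegers_smul_eq E γ 𝔓₀, hγ]
    ext y
    rw [Ideal.mem_pointwise_smul_iff_inv_smul_mem, Ideal.mem_comap, Ideal.mem_comap]
    refine (hιmem (g⁻¹ • y)).trans (Iff.trans ?_ (hιmem y).symm)
    -- `ε⁻¹ (g⁻¹ y) = g₀⁻¹ (ε⁻¹ y)`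
    have hy : ε.symm ((g⁻¹ • y : 𝓞 E) : E) = g₀⁻¹ (ε.symm (y : E)) := by
      change ε.symm (g.symm (y : E)) = g₀.symm (ε.symm (y : E))
      rw [hgdef]
      simp only [AlgEquiv.symm_trans_apply, AlgEquiv.symm_symm, AlgEquiv.symm_apply_apply]
    rw [hy]
    -- both sides are membership in `w` of integers of `L`
    have hint : IsIntegral ℤ (ε.symm (y : E)) := by
      have := (y.2 : IsIntegral ℤ (y : E))
      exact this.map (ε.symm : E →ₐ[K] L).toIntAlgHom
    have hint' : IsIntegral ℤ (g₀⁻¹ (ε.symm (y : E))) := hint.map (g₀⁻¹ : L ≃ₐ[K] L).toAlgHom.toIntAlgHom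
    set z : 𝓞 L := ⟨ε.symm (y : E), hint⟩ with hzdef
    set z' : 𝓞 L := ⟨g₀⁻¹ (ε.symm (y : E)), hint'⟩ with hz'def
    have h1 := hmem e hwe z
    have h2 := hmem e hwe z'
    have h3 := hstab z'
    -- `g₀ • (g₀⁻¹ z) = z`
    have h4 : g₀ • z' = z := by
      apply Subtype.ext
      change g₀ (g₀⁻¹ (ε.symm (y : E))) = ε.symm (y : E)
      exact AlgEquiv.apply_symm_apply g₀ _
    rw [h4] at h3
    exact h2.symm.trans (h3.symm.trans h1)
  -- transitivity of `Γ_E = Gal(K̄/E)` on the primes of `ℤ̄` above `𝔓₀ ∩ 𝓞 E`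
  set Γ_E := E.fixingSubgroup.comap (absoluteGaloisGroup.toAlgEquiv K).toMonoidHom with hΓE
  letI : Algebra (𝓞 E) (absIntegers (𝓞 K) K) := ι.toAlgebra
  obtain ⟨hcomm, hinv⟩ := isInvariant_absIntegers_fixingSubgroup (F := K) E
  haveI := hcomm
  haveI := hinv
  have hclosed : IsClosed (Γ_E : Set (absoluteGaloisGroup K)) := InfiniteGalois.fixingSubgroup_isClosed E
  haveI : CompactSpace Γ_E := isCompact_iff_compactSpace.mp hclosed.isCompact
  letI : TopologicalSpace (absIntegers (𝓞 K) K) := ⊥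
  haveI : DiscreteTopology (absIntegers (𝓞 K) K) := ⟨rfl⟩
  haveI := absIntegers.continuousSMul (𝓞 K) (K := K)
  haveI : (γ • 𝔓₀).IsPrime := (Ideal.IsPrime.smul_iff γ).mpr h𝔓₀p
  have hunder : (𝔓₀).under (𝓞 E) = (γ • 𝔓₀).under (𝓞 E) := by
    change 𝔓₀.comap ι = (γ • 𝔓₀).comap ι
    rw [htrace]
  obtain ⟨τ, hτ⟩ := Algebra.IsInvariant.exists_smul_of_under_eq_of_profinite (A := 𝓞 E)
    (B := absIntegers (𝓞 K) K) (G := Γ_E) 𝔓₀ (γ • 𝔓₀) hunder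
  -- `δ = τ⁻¹ γ` fixes `𝔓₀`, hence comes from `Γ_{K_v}`
  set δ : absoluteGaloisGroup K := (τ : absoluteGaloisGroup K)⁻¹ * γ with hδdef
  have hδ : δ ∈ 𝔓₀.decompositionSubgroup (absoluteGaloisGroup K) := by
    rw [Ideal.decompositionSubgroup, MulAction.mem_stabilizer_iff, hδdef, mul_smul]
    have hτ' : (τ : absoluteGaloisGroup K) • 𝔓₀ = γ • 𝔓₀ := hτ.symm
    rw [← hτ', inv_smul_smul]
  rw [h𝔓₀def, decompositionSubgroup_adicCompletionPrime_eq_range] at hδ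
  obtain ⟨t, ht⟩ := hδ
  have hτfix : ∀ x : L, (τ : absoluteGaloisGroup K)⁻¹ • e x = e x := fun x ↦
    (mem_fixingSubgroup_comap_iff E _).mp (Subgroup.inv_mem _ τ.2) (e x) ⟨x, rfl⟩
  refine ⟨t, fun x ↦ ?_⟩
  have hres : resGal (K := K) (v.adicCompletion K) t = δ := by
    rw [resGal_eq_absGaloisRestrict]; exact ht
  rw [hres]
  change δ • e x = e' x
  rw [hδdef, mul_smul, hγe, hτfix, hg₀]

/-- **Push-forwards along embeddings cutting out the same place differ by `Γ_{K_v}`**: with `e, e', w, t` as in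
`exists_resGal_apply_eq_of_isEquiv` and `W/ℚ`, for every `P ∈ E(L)`:
`pointsMap (W ⊗ K) K_v (Point.map e' P) = t • pointsMap (W ⊗ K) K_v (Point.map e P)`. [cite: NeukirchANT1999, Ch. II §9 Prop. (9.6)] -/
theorem pointsMap_map_eq_smul_of_forall_apply_eq (W : WeierstrassCurve ℚ)
    (e e' : L →ₐ[K] AlgebraicClosure K) {t : absoluteGaloisGroup (v.adicCompletion K)}
    (ht : ∀ x : L,
      (show AlgebraicClosure K ≃ₐ[K] AlgebraicClosure K from resGal (K := K) (v.adicCompletion K) t) (e x) = e' x)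
    (P : (W.baseChange L).toAffine.Point) :
    pointsMap (W.baseChange K) (v.adicCompletion K) (Affine.Point.map (W' := W) (e'.restrictScalars ℚ) P) =
      t • pointsMap (W.baseChange K) (v.adicCompletion K) (Affine.Point.map (W' := W) (e.restrictScalars ℚ) P) := by
  set Q : geomPoints (W.baseChange K) := Affine.Point.map (W' := W) (e.restrictScalars ℚ) P with hQdef
  set Q' : geomPoints (W.baseChange K) := Affine.Point.map (W' := W) (e'.restrictScalars ℚ) P with hQ'def
  have key : resGal (K := K) (v.adicCompletion K) t • Q = Q' := by
    rcases P with _ | ⟨x, y, h⟩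
    · have hQ0 : Q = 0 := rfl
      have hQ'0 : Q' = 0 := rfl
      rw [hQ0, hQ'0, smul_zero]
    · have hxy : ((W.baseChange K).baseChange (AlgebraicClosure K)).toAffine.Nonsingular (e x) (e y) :=
        (Affine.baseChange_nonsingular W (e.restrictScalars ℚ).injective x y).mpr h
      have hxy' : ((W.baseChange K).baseChange (AlgebraicClosure K)).toAffine.Nonsingular (e' x) (e' y) :=
        (Affine.baseChange_nonsingular W (e'.restrictScalars ℚ).injective x y).mpr h
      have hQ : Q = (.some (e x) (e y) hxy : geomPoints (W.baseChange K)) := by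
        rw [hQdef, Affine.Point.map_some]; rfl
      have hQ' : Q' = (.some (e' x) (e' y) hxy' : geomPoints (W.baseChange K)) := by
        rw [hQ'def, Affine.Point.map_some]; rfl
      rw [hQ, hQ']
      change Affine.Point.map (W' := W.baseChange K)
        ((show AlgebraicClosure K ≃ₐ[K] AlgebraicClosure K from resGal (K := K) (v.adicCompletion K) t) :
          AlgebraicClosure K →ₐ[K] AlgebraicClosure K) (.some (e x) (e y) hxy) = _
      rw [Affine.Point.map_some]
      exact Affine.Point.some_eq_some_of_eq (ht x) (ht y)
  change pointsMap (W.baseChange K) (v.adicCompletion K) Q' = t • pointsMap (W.baseChange K) (v.adicCompletion K) Q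
  rw [← key, pointsMap_smul]

end Summit.BirchSwinnertonDyer.BirchSwinnertonDyer.Theorems.TateComponent

end
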